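import Literature.Barriers.CriticalPhenomena.RigorousRGSmallParameterPolymerGas
import HarnessLib

/-!
# `RigorousRGSmallParameter` (Slade, Theorem 1.4.1): Brydges' change of variables for the
# nonperturbative coordinate — `(I ∘ K_out)(Λ) = (I ∘ K_in)(Λ)` ([BS-rg-step] §4.1 / appendix)

Companion ("proof architecture") file of
`Literature/Barriers/CriticalPhenomena/RigorousRGSmallParameter.lean`. The renormalisation-group
map `(V,K) ↦ (U₊,K₊)` of Slade's Theorem 6.3.1 (iterated in the named fact `Slade2017_prop822`)
"is defined in [BS-rg-step]" (Slade §6.3) as a composition of six maps ([BS-rg-step] §3.1);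
Map 1 ("transfer from small sets to block") and Map 4 ("reapportionment of `K^{(3)}`") are two
applications of the *change of variables* of [BS-rg-step] §4.1:

> "Suppose we have a mapping `J : 𝒞 × ℬ → 𝒩` which obeys `J(U,B) = 0` if `(U,B) ∉ 𝒟(J)`",
> `𝒟(J) = {(U,B) ∈ 𝒮 × ℬ : U ⊇ B}`, "… For `K_in ∈ 𝒦` and `U ∈ 𝒞`, let
> `M(U) = K_in(U) - I_in^U Σ_{B ∈ ℬ(U)} J(U,B)`. … Then there exists `K_out ∈ 𝒦` such that
> `(I_in ∘ K_out)(Λ) = (I_in ∘ K_in)(Λ)`, `K_out` is polynomial in `I_in, J̄, K_in` (with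
> `J̄(U,B) = I_in^U J(U,B)`) … If `K_in = 0` and `J = 0`, then `K_out = 0`."

with `K_out` given explicitly in the appendix "Change of variables" (arXiv:1403.7256 §11):

> `K_out(W) = Σ_{(X,{(U_B,B)},U_M) ∈ 𝒴(W)} (∏_{B ∈ ℬ(X)} J̄(U_B,B)) M(U_M) I_in^{W∖(U_M ∪ U_J)}`,
> "`𝒴(W)` denotes the set of triples `(X, {(U_B,B)}, U_M)`, with `X ∈ 𝒫(W)`,
> `{(U_B,B)} ∈ 𝒰(X)` [`U_{B_i} ⊃ B_i` pairwise non-touching], `U_M ∈ 𝒫'(Λ∖U_J)` [polymers not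
> touching `U_J = ∪_B U_B`], and `X^□ ∪ U_M = W`", `M(U_M) = ∏_{components} M`.

This file formalises, for activities with values in an arbitrary commutative ring `R` (for the
RG: the algebra `𝒩` of functions of the field) and a block activity `I` entering through
`I^X = ∏_{B ∈ ℬ(X)} I(B)`: the objects `𝒟(J)`, `J̄`, `M`, the index set `𝒴(W)` (encoded by
`S = {(U_B,B)}` and `𝒱 = Comp(U_M)`), **`kout`** (`K_out`, display (e:Kdef-new) of the proof), and
PROVES the identity **`circ_blockProd_kout_univ`**: `(I ∘ K_out)(Λ) = (I ∘ K_in)(Λ)` for every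
component-factorising `K_in` and every `J` supported on `𝒟(J)` — following the printed proof:
expand `∏_{U ∈ Comp(U_in)}(J̄(U) + M(U))` (over gases and sections:
`prod_eq_sum_cvTerm`, `sum_gasSet_sum_sectionSet_eq_sum_cvIndex`), then regroup by
`W = X^□ ∪ U_M` using `U_J ⊆ X^□` and `I^{Λ∖(U_M∪U_J)} = I^{Λ∖W} I^{W∖(U_M∪U_J)}`. Also proved:
`kout_empty` (`K_out(∅) = 1`), **`kout_eq_of_forall_eq_zero`** ("if `J = 0` then
`K_out = K_in`"), and the structural cancellation of the proof of the bound (e:Koutbd-KM): under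
`Σ_{U : (U,B) ∈ 𝒟(J)} J(U,B) = 0` ((4.2)) the single-pair terms (`|X| = 1`, `U_M = ∅`) of `K_out(W)`
sum to zero (**`sum_cvFiberSingle_eq_zero`**, "This feature is a crucial ingredient") and
`K_out(W) - M(W) = Σ_{𝒴₀(W)} ⋯` (**`kout_sub_prod_mfun_eq`**). The identity itself does not use the
cancellation condition. Component factorisation and field locality of `K_out` (so that
`K_out ∈ 𝒦`) are in `RigorousRGSmallParameterKChangeOfVariablesFactorisation.lean`; the norm
estimate (e:Koutbd-KM) (needs [BS-rg-step] Lemma "lem:Y0" and the product property) is not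
treated here.

Remark (faithfulness): the worked example "(e:Kdef-new-ex)" printed after the formula,
`K_out(B) = M(B) + Σ_{U:(U,B)∈𝒟(J)} J̄(U,B)` for a single block `W = B`, is not a consequence of
the displayed definition (a single-pair index contributes to `W = B^□`, as the paper's own
cancellation argument (e:Jcancel) states); we formalise the displayed definition (e:Kdef-new).

Sources: D. C. Brydges, G. Slade, J. Stat. Phys. 159 (2015) 589–667, arXiv:1403.7256, §4.1
(statement), appendix "Change of variables" (arXiv §11, proof), §4.2 (use in Map 1);
G. Slade, arXiv:1611.06169, §6.1 (`𝒦_j`, circle product), §6.3 ("The maps are defined in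
[BS-rg-step]").

## References

* [BrydgesSlade2015RGV] D. C. Brydges, G. Slade, *A renormalisation group method. V. A single
  renormalisation group step*, J. Stat. Phys. **159** (2015) 589–667, arXiv:1403.7256.
* [Slade2017] G. Slade, *Critical exponents for long-range O(n) models below the upper critical
  dimension*, Commun. Math. Phys. **358** (2018) 343–436, arXiv:1611.06169.
-/

noncomputable section

open Finset

namespace Literature.Barriers.CriticalPhenomena

namespace LongRangePhi4

namespace Polymer

open Literature.Probability.LatticeModels

variable {d M : ℕ} [NeZero M]


/-! ## Brydges' change of variables ([BS-rg-step] Proposition 4.1.1 / Appendix §11), algebraic part -/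

section ChangeOfVariables

variable {R : Type*} [CommRing R]

open Classical in
/-- `𝒟(J) = {(U, B) ∈ 𝒮 × ℬ : U ⊇ B}`: pairs (small set, block inside it).
[cite: BrydgesSlade2015RGV, (4.1) (definition of 𝒟(J))] -/
def djSet (b : ℕ) : Finset (Finset (TorusSite d M) × Finset (TorusSite d M)) :=
  univ.filter fun p => IsSmall b p.1 ∧ p.2 ∈ blocksOf b p.1

/-- Membership in `djSet`. [folklore] -/
@[simp] theorem mem_djSet {b : ℕ} {p : Finset (TorusSite d M) × Finset (TorusSite d M)} :
    p ∈ djSet b ↔ IsSmall b p.1 ∧ p.2 ∈ blocksOf b p.1 := by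
  classical
  simp [djSet]

open Classical in
/-- The connected `b`-polymers `𝒞_j`. [cite: Slade2017, §6.1 (𝒞_j)] -/
def connSet (b : ℕ) : Finset (Finset (TorusSite d M)) := univ.filter fun Y => IsPolymer b Y ∧ IsConn Y

/-- Membership in `connSet`. [folklore] -/
@[simp] theorem mem_connSet {b : ℕ} {Y : Finset (TorusSite d M)} : Y ∈ connSet b ↔ IsPolymer b Y ∧ IsConn Y := by
  classical
  simp [connSet]

/-- `J̄(U, B) = I^U J(U, B)`. [cite: BrydgesSlade2015RGV, Proposition 4.1.1 ((e:Kout-poly): "with J̄(U,B) = I^U J(U,B)")] -/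
def jbar (b : ℕ) (I : Finset (TorusSite d M) → R) (J : Finset (TorusSite d M) → Finset (TorusSite d M) → R)
    (p : Finset (TorusSite d M) × Finset (TorusSite d M)) : R :=
  blockProd b I p.1 * J p.1 p.2

/-- `M(U) = K_in(U) - I^U Σ_{B ∈ ℬ(U)} J(U, B)` (used for connected `U`).
[cite: BrydgesSlade2015RGV, (4.5) (definition of M)] -/
def mfun (b : ℕ) (I : Finset (TorusSite d M) → R) (K : Finset (TorusSite d M) → R)
    (J : Finset (TorusSite d M) → Finset (TorusSite d M) → R) (U : Finset (TorusSite d M)) : R :=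
  K U - blockProd b I U * ∑ B ∈ blocksOf b U, J U B

/-- `X(S) = ⋃_{(U,B) ∈ S} B` (the polymer whose blocks are the chosen blocks). [cite: BrydgesSlade2015RGV, Appendix §11 (definition of 𝒰(X))] -/
def xOf (S : Finset (Finset (TorusSite d M) × Finset (TorusSite d M))) : Finset (TorusSite d M) := S.biUnion Prod.snd

/-- `U_J(S) = ⋃_{(U,B) ∈ S} U`. [cite: BrydgesSlade2015RGV, Appendix §11 ("we write U_J = ∪_{B ∈ ℬ(X)} U_B")] -/
def ujOf (S : Finset (Finset (TorusSite d M) × Finset (TorusSite d M))) : Finset (TorusSite d M) := S.biUnion Prod.fst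

/-- Admissible index `(S, 𝒱)`: `S ⊆ 𝒟(J)` a family `{(U_B, B)}` of pairwise non-touching small sets
with chosen blocks, `𝒱` a family of connected polymers (the components of `U_M`), all members of
`S` and `𝒱` pairwise non-touching ("`U_{B_i}` does not touch `U_{B_j}` for `i ≠ j`";
"`U_M ∈ 𝒫'(Λ ∖ U_J)`, the set of polymers that do not touch `U_J`"). [cite: BrydgesSlade2015RGV, Appendix §11 (definitions of 𝒰(X), 𝒫'(Λ∖U_J), 𝒴(W))] -/
def CvAdm (b : ℕ) (S : Finset (Finset (TorusSite d M) × Finset (TorusSite d M))) (𝒱 : Finset (Finset (TorusSite d M))) :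
    Prop :=
  S ⊆ djSet b ∧ 𝒱 ⊆ connSet b ∧ (∀ p ∈ S, ∀ q ∈ S, p ≠ q → ¬ Touch p.1 q.1) ∧
    (∀ V ∈ 𝒱, ∀ V' ∈ 𝒱, V ≠ V' → ¬ Touch V V') ∧ (∀ p ∈ S, ∀ V ∈ 𝒱, ¬ Touch p.1 V)

open Classical in
/-- The finite set of admissible indices `(S, 𝒱)`. [cite: BrydgesSlade2015RGV, Appendix §11 (𝒴(W))] -/
def cvIndex (b : ℕ) : Finset (Finset (Finset (TorusSite d M) × Finset (TorusSite d M)) × Finset (Finset (TorusSite d M))) :=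
  ((djSet b).powerset ×ˢ (connSet b).powerset).filter fun q => CvAdm b q.1 q.2

/-- Membership in `cvIndex`. [folklore] -/
@[simp] theorem mem_cvIndex {b : ℕ}
    {q : Finset (Finset (TorusSite d M) × Finset (TorusSite d M)) × Finset (Finset (TorusSite d M))} :
    q ∈ cvIndex b ↔ CvAdm b q.1 q.2 := by
  classical
  simp only [cvIndex, mem_filter, mem_product, mem_powerset, and_iff_right_iff_imp]
  exact fun h => ⟨h.1, h.2.1⟩

/-- The polymer `W(S, 𝒱) = X(S)^□ ∪ U_M` on which the index `(S, 𝒱)` contributes to `K_out`.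
[cite: BrydgesSlade2015RGV, Appendix §11 ("For W = X^□ ∪ U_M")] -/
def cvW (b : ℕ) (q : Finset (Finset (TorusSite d M) × Finset (TorusSite d M)) × Finset (Finset (TorusSite d M))) :
    Finset (TorusSite d M) :=
  sclosure b (xOf q.1) ∪ q.2.biUnion id

/-- The support `U_J ∪ U_M` of the index `(S, 𝒱)`. [cite: BrydgesSlade2015RGV, Appendix §11] -/
def cvSupp (q : Finset (Finset (TorusSite d M) × Finset (TorusSite d M)) × Finset (Finset (TorusSite d M))) :
    Finset (TorusSite d M) :=
  ujOf q.1 ∪ q.2.biUnion id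

/-- The weight `(∏_{(U,B) ∈ S} J̄(U,B)) · ∏_{V ∈ 𝒱} M(V)` of an index. [cite: BrydgesSlade2015RGV, Appendix §11, (e:Kdef-new)] -/
def cvTerm (b : ℕ) (I : Finset (TorusSite d M) → R) (K : Finset (TorusSite d M) → R)
    (J : Finset (TorusSite d M) → Finset (TorusSite d M) → R)
    (q : Finset (Finset (TorusSite d M) × Finset (TorusSite d M)) × Finset (Finset (TorusSite d M))) : R :=
  (∏ p ∈ q.1, jbar b I J p) * ∏ V ∈ q.2, mfun b I K J V

open Classical in
/-- The indices contributing to `K_out(W)`: `𝒴(W) = {(S, 𝒱) admissible : X(S)^□ ∪ U_M = W}`.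
[cite: BrydgesSlade2015RGV, Appendix §11 (𝒴(W))] -/
def cvFiber (b : ℕ) (W : Finset (TorusSite d M)) :
    Finset (Finset (Finset (TorusSite d M) × Finset (TorusSite d M)) × Finset (Finset (TorusSite d M))) :=
  (cvIndex b).filter fun q => cvW b q = W

/-- Membership in `cvFiber`. [folklore] -/
@[simp] theorem mem_cvFiber {b : ℕ} {W : Finset (TorusSite d M)}
    {q : Finset (Finset (TorusSite d M) × Finset (TorusSite d M)) × Finset (Finset (TorusSite d M))} :
    q ∈ cvFiber b W ↔ CvAdm b q.1 q.2 ∧ cvW b q = W := by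
  classical
  simp [cvFiber]

/-- **Brydges' change of variables, the new coordinate `K_out`** ([BS-rg-step] (e:Kdef-new)):
`K_out(W) = Σ_{(X,{(U_B,B)},U_M) ∈ 𝒴(W)} (∏_{B ∈ ℬ(X)} J̄(U_B,B)) M(U_M) I^{W ∖ (U_M ∪ U_J)}`, where
`M(U_M) = ∏_{components} M`, indexed here by `S = {(U_B, B)}` and `𝒱 = Comp(U_M)`.
[cite: BrydgesSlade2015RGV, Appendix §11, (e:Kdef-new) (proof of Proposition 4.1.1)] -/
def kout (b : ℕ) (I : Finset (TorusSite d M) → R) (K : Finset (TorusSite d M) → R)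
    (J : Finset (TorusSite d M) → Finset (TorusSite d M) → R) (W : Finset (TorusSite d M)) : R :=
  ∑ q ∈ cvFiber b W, cvTerm b I K J q * blockProd b I (W \ cvSupp q)

/-! ### Geometry of admissible indices -/

/-- For `(U, B) ∈ 𝒟(J)`: `U` is a connected polymer. [folklore] -/
theorem isPolymer_isConn_of_mem_djSet {b : ℕ} {p : Finset (TorusSite d M) × Finset (TorusSite d M)}
    (hp : p ∈ djSet b) : IsPolymer b p.1 ∧ IsConn p.1 :=
  ⟨(mem_djSet.1 hp).1.1, (mem_djSet.1 hp).1.2.1⟩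

/-- For `(U, B) ∈ 𝒟(J)`: `U ⊆ X^□` whenever `B ⊆ X` — small sets through a block of `X` lie in
`X^□` ("the small set neighbourhood `X^□` contains all possible unions `U_J` of small sets in the
summation over the `U_B`"). [cite: BrydgesSlade2015RGV, Appendix §11] -/
theorem fst_subset_sclosure_of_mem_djSet {b : ℕ} {p : Finset (TorusSite d M) × Finset (TorusSite d M)}
    (hp : p ∈ djSet b) {X : Finset (TorusSite d M)} (hBX : p.2 ⊆ X) : p.1 ⊆ sclosure b X := by
  obtain ⟨hsmall, hB⟩ := mem_djSet.1 hp
  obtain ⟨x, hx⟩ := nonempty_of_mem_blocksOf hB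
  intro y hy
  exact mem_sclosure.2 ⟨p.1, hsmall, ⟨x, mem_inter.2 ⟨hBX hx, subset_of_mem_blocksOf hsmall.1 hB hx⟩⟩, hy⟩

/-- `U_J(S) ⊆ X(S)^□` for `S ⊆ 𝒟(J)`. [cite: BrydgesSlade2015RGV, Appendix §11] -/
theorem ujOf_subset_sclosure_xOf {b : ℕ} {S : Finset (Finset (TorusSite d M) × Finset (TorusSite d M))}
    (hS : S ⊆ djSet b) : ujOf S ⊆ sclosure b (xOf S) := by
  classical
  intro y hy
  obtain ⟨p, hp, hyp⟩ := mem_biUnion.1 hy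
  exact fst_subset_sclosure_of_mem_djSet (hS hp) (fun z hz => mem_biUnion.2 ⟨p, hp, hz⟩) hyp

/-- `U_J(S)` is a polymer. [folklore] -/
theorem isPolymer_ujOf {b : ℕ} {S : Finset (Finset (TorusSite d M) × Finset (TorusSite d M))}
    (hS : S ⊆ djSet b) : IsPolymer b (ujOf S) := by
  classical
  intro y hy
  obtain ⟨p, hp, hyp⟩ := mem_biUnion.1 hy
  exact ((isPolymer_isConn_of_mem_djSet (hS hp)).1 hyp).trans fun z hz => mem_biUnion.2 ⟨p, hp, hz⟩

/-- A union of polymers is a polymer. [folklore] -/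
theorem isPolymer_biUnion_id {b : ℕ} {𝒱 : Finset (Finset (TorusSite d M))} (h : ∀ V ∈ 𝒱, IsPolymer b V) :
    IsPolymer b (𝒱.biUnion id) := by
  classical
  intro y hy
  obtain ⟨V, hV, hyV⟩ := mem_biUnion.1 hy
  exact (h V hV hyV).trans fun z hz => mem_biUnion.2 ⟨V, hV, hz⟩

/-- The support of an admissible index is a polymer. [folklore] -/
theorem CvAdm.isPolymer_cvSupp {b : ℕ} {S : Finset (Finset (TorusSite d M) × Finset (TorusSite d M))}
    {𝒱 : Finset (Finset (TorusSite d M))} (h : CvAdm b S 𝒱) : IsPolymer b (cvSupp (S, 𝒱)) :=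
  (isPolymer_ujOf h.1).union (isPolymer_biUnion_id fun _ hV => (mem_connSet.1 (h.2.1 hV)).1)

/-- `W(S, 𝒱)` is a polymer. [folklore] -/
theorem CvAdm.isPolymer_cvW {b : ℕ} {S : Finset (Finset (TorusSite d M) × Finset (TorusSite d M))}
    {𝒱 : Finset (Finset (TorusSite d M))} (h : CvAdm b S 𝒱) : IsPolymer b (cvW b (S, 𝒱)) :=
  (isPolymer_sclosure b _).union (isPolymer_biUnion_id fun _ hV => (mem_connSet.1 (h.2.1 hV)).1)

/-- `U_J ∪ U_M ⊆ W(S, 𝒱)`. [cite: BrydgesSlade2015RGV, Appendix §11] -/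
theorem CvAdm.cvSupp_subset_cvW {b : ℕ} {S : Finset (Finset (TorusSite d M) × Finset (TorusSite d M))}
    {𝒱 : Finset (Finset (TorusSite d M))} (h : CvAdm b S 𝒱) : cvSupp (S, 𝒱) ⊆ cvW b (S, 𝒱) :=
  union_subset_union (ujOf_subset_sclosure_xOf h.1) (subset_refl _)

/-- **Splitting the background**: `I^{Λ ∖ (U_M ∪ U_J)} = I^{Λ ∖ W} I^{W ∖ (U_M ∪ U_J)}`.
[cite: BrydgesSlade2015RGV, Appendix §11 (display before (e:Kdef-new))] -/
theorem CvAdm.blockProd_univ_sdiff_cvSupp {b : ℕ} (I : Finset (TorusSite d M) → R)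
    {S : Finset (Finset (TorusSite d M) × Finset (TorusSite d M))} {𝒱 : Finset (Finset (TorusSite d M))}
    (h : CvAdm b S 𝒱) :
    blockProd b I (univ \ cvSupp (S, 𝒱)) =
      blockProd b I (univ \ cvW b (S, 𝒱)) * blockProd b I (cvW b (S, 𝒱) \ cvSupp (S, 𝒱)) := by
  have hsub := h.cvSupp_subset_cvW
  have e : univ \ cvSupp (S, 𝒱) = (univ \ cvW b (S, 𝒱)) ∪ (cvW b (S, 𝒱) \ cvSupp (S, 𝒱)) := by
    ext x
    simp only [mem_sdiff, mem_univ, true_and, mem_union]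
    constructor
    · intro hx
      by_cases hW : x ∈ cvW b (S, 𝒱)
      · exact Or.inr ⟨hW, hx⟩
      · exact Or.inl hW
    · rintro (hx | ⟨-, hx⟩)
      · exact fun h' => hx (hsub h')
      · exact hx
  rw [e, blockProd_union I ((isPolymer_univ b).sdiff h.isPolymer_cvW) (h.isPolymer_cvW.sdiff h.isPolymer_cvSupp)]
  exact disjoint_left.2 fun x hx hx' => (mem_sdiff.1 hx).2 (mem_sdiff.1 hx').1

/-! ### Expansion of `∏_{Y ∈ Comp(U_in)} (J̄(Y) + M(Y))` -/

open Classical in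
/-- Colours available above a connected polymer `Y`: its blocks if `Y` is small (the terms
`J̄(Y, B)`), none otherwise. [cite: BrydgesSlade2015RGV, Appendix §11 ((e:JprimeUdef)–(e:JprimeUdef2))] -/
def dcol (b : ℕ) (Y : Finset (TorusSite d M)) : Finset (Finset (TorusSite d M)) :=
  if IsSmall b Y then blocksOf b Y else ∅

/-- Membership in `dcol`. [folklore] -/
@[simp] theorem mem_dcol {b : ℕ} {Y B : Finset (TorusSite d M)} : B ∈ dcol b Y ↔ IsSmall b Y ∧ B ∈ blocksOf b Y := by
  unfold dcol
  split_ifs with h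
  · simp [h]
  · simp [h]

variable (b : ℕ) (I : Finset (TorusSite d M) → R) (K : Finset (TorusSite d M) → R)
  (J : Finset (TorusSite d M) → Finset (TorusSite d M) → R)

/-- `K_in(U) = M(U) + J̄(U)` with `J̄(U) = Σ_{B ∈ ℬ(U)} J̄(U, B)` (zero unless `U` is small), for `J`
supported on `𝒟(J)`. [cite: BrydgesSlade2015RGV, Appendix §11 ((e:JprimeUdef), second line of (11.3))] -/
theorem eq_mfun_add_sum_jbar (hJ : ∀ U B, J U B ≠ 0 → IsSmall b U ∧ B ∈ blocksOf b U) (Y : Finset (TorusSite d M)) :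
    K Y = mfun b I K J Y + ∑ B ∈ dcol b Y, jbar b I J (Y, B) := by
  unfold mfun dcol jbar
  split_ifs with h
  · show K Y = K Y - blockProd b I Y * ∑ B ∈ blocksOf b Y, J Y B + ∑ x ∈ blocksOf b Y, blockProd b I Y * J Y x
    rw [← Finset.mul_sum]
    ring
  · have : ∑ B ∈ blocksOf b Y, J Y B = 0 := by
      refine Finset.sum_eq_zero fun B _ => ?_
      by_contra hne
      exact h (hJ Y B hne).1
    simp [this]

/-- **Expansion over one gas** (`= Comp(U_in)`):
`∏_{Y ∈ 𝒢} K_in(Y) = Σ_{𝒱 ⊆ 𝒢} Σ_{S section of colours over 𝒢 ∖ 𝒱} (∏_{(U,B) ∈ S} J̄(U,B)) ∏_{V ∈ 𝒱} M(V)`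
("`∏_{U ∈ Comp(U_in)} (J̄(U) + M(U)) = Σ_{Û_M ⊂ Comp(U_in)} J̄(U_in ∖ U_M) M(U_M)`", then
interchanging the sums over blocks and the product). [cite: BrydgesSlade2015RGV, Appendix §11 ((11.3)–(11.5))] -/
theorem prod_eq_sum_cvTerm (hJ : ∀ U B, J U B ≠ 0 → IsSmall b U ∧ B ∈ blocksOf b U)
    (G : Finset (Finset (TorusSite d M))) :
    ∏ Y ∈ G, K Y = ∑ 𝒱 ∈ G.powerset, ∑ S ∈ sectionSet (G \ 𝒱) (dcol b), cvTerm b I K J (S, 𝒱) := by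
  classical
  rw [Finset.prod_congr rfl fun Y _ => eq_mfun_add_sum_jbar b I K J hJ Y, Finset.prod_add]
  refine Finset.sum_congr rfl fun 𝒱 _ => ?_
  rw [prod_sum_eq_sum_sectionSet (G \ 𝒱) (dcol b) (jbar b I J), Finset.mul_sum]
  refine Finset.sum_congr rfl fun S _ => ?_
  unfold cvTerm
  ring

variable {b}

/-- From gas data `(𝒢, 𝒱 ⊆ 𝒢, S)` to an admissible index `(S, 𝒱)`. [cite: BrydgesSlade2015RGV, Appendix §11] -/
theorem cvAdm_of_isSection {G 𝒱 : Finset (Finset (TorusSite d M))} (hG : IsGas b G) (h𝒱 : 𝒱 ⊆ G)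
    {S : Finset (Finset (TorusSite d M) × Finset (TorusSite d M))} (hS : IsSection (G \ 𝒱) (dcol b) S) :
    CvAdm b S 𝒱 := by
  have hfst : ∀ p ∈ S, p.1 ∈ G ∧ p.1 ∉ 𝒱 := fun p hp => mem_sdiff.1 (hS.fst_mem hp)
  refine ⟨?_, ?_, ?_, ?_, ?_⟩
  · intro p hp
    have := (mem_pairsOf.1 (hS.1 hp)).2
    exact mem_djSet.2 (mem_dcol.1 this)
  · intro V hV
    exact mem_connSet.2 (hG.1 V (h𝒱 hV))
  · intro p hp q hq hpq
    refine hG.2 p.1 (hfst p hp).1 q.1 (hfst q hq).1 fun h => hpq (hS.eq_of_fst_eq hp hq h)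
  · intro V hV V' hV' hne
    exact hG.2 V (h𝒱 hV) V' (h𝒱 hV') hne
  · intro p hp V hV
    exact hG.2 p.1 (hfst p hp).1 V (h𝒱 hV) fun h => (hfst p hp).2 (h ▸ hV)

/-- Members of an admissible `S` have nonempty first coordinate. [folklore] -/
theorem CvAdm.fst_nonempty {S : Finset (Finset (TorusSite d M) × Finset (TorusSite d M))}
    {𝒱 : Finset (Finset (TorusSite d M))} (h : CvAdm b S 𝒱) {p : Finset (TorusSite d M) × Finset (TorusSite d M)}
    (hp : p ∈ S) : p.1.Nonempty :=
  (isPolymer_isConn_of_mem_djSet (h.1 hp)).2.1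

/-- In an admissible `S`, the first projection is injective. [folklore] -/
theorem CvAdm.eq_of_fst_eq {S : Finset (Finset (TorusSite d M) × Finset (TorusSite d M))}
    {𝒱 : Finset (Finset (TorusSite d M))} (h : CvAdm b S 𝒱) {p q : Finset (TorusSite d M) × Finset (TorusSite d M)}
    (hp : p ∈ S) (hq : q ∈ S) (hpq : p.1 = q.1) : p = q := by
  by_contra hne
  have := h.2.2.1 p hp q hq hne
  rw [hpq] at this
  exact this (touch_self (h.fst_nonempty hq))

/-- In an admissible index, `S`-polymers are not members of `𝒱`. [folklore] -/
theorem CvAdm.disjoint_image_fst {S : Finset (Finset (TorusSite d M) × Finset (TorusSite d M))}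
    {𝒱 : Finset (Finset (TorusSite d M))} (h : CvAdm b S 𝒱) : Disjoint (S.image Prod.fst) 𝒱 := by
  classical
  rw [Finset.disjoint_left]
  intro U hU hU𝒱
  obtain ⟨p, hp, rfl⟩ := mem_image.1 hU
  exact h.2.2.2.2 p hp p.1 hU𝒱 (touch_self (h.fst_nonempty hp))

/-- From an admissible index `(S, 𝒱)` back to the gas `{U_B} ∪ 𝒱`. [cite: BrydgesSlade2015RGV, Appendix §11] -/
theorem CvAdm.isGas {S : Finset (Finset (TorusSite d M) × Finset (TorusSite d M))}
    {𝒱 : Finset (Finset (TorusSite d M))} (h : CvAdm b S 𝒱) : IsGas b (S.image Prod.fst ∪ 𝒱) := by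
  classical
  refine ⟨?_, ?_⟩
  · intro Y hY
    rcases mem_union.1 hY with hY | hY
    · obtain ⟨p, hp, rfl⟩ := mem_image.1 hY
      exact isPolymer_isConn_of_mem_djSet (h.1 hp)
    · exact mem_connSet.1 (h.2.1 hY)
  · intro Y₁ h₁ Y₂ h₂ hne
    rcases mem_union.1 h₁ with h₁ | h₁ <;> rcases mem_union.1 h₂ with h₂ | h₂
    · obtain ⟨p, hp, rfl⟩ := mem_image.1 h₁
      obtain ⟨q, hq, rfl⟩ := mem_image.1 h₂
      exact h.2.2.1 p hp q hq fun e => hne (by rw [e])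
    · obtain ⟨p, hp, rfl⟩ := mem_image.1 h₁
      exact h.2.2.2.2 p hp Y₂ h₂
    · obtain ⟨q, hq, rfl⟩ := mem_image.1 h₂
      exact fun ht => h.2.2.2.2 q hq Y₁ h₁ ht.symm
    · exact h.2.2.2.1 Y₁ h₁ Y₂ h₂ hne

/-- The admissible `S` is a section of the colours over its first projection. [folklore] -/
theorem CvAdm.isSection {S : Finset (Finset (TorusSite d M) × Finset (TorusSite d M))}
    {𝒱 : Finset (Finset (TorusSite d M))} (h : CvAdm b S 𝒱) : IsSection (S.image Prod.fst) (dcol b) S := by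
  classical
  refine isSection_image_fst (fun p hp => mem_dcol.2 (mem_djSet.1 (h.1 hp))) ?_
  intro p hp q hq hpq
  exact h.eq_of_fst_eq hp hq hpq

omit [NeZero M] in
/-- The union of the gas `{U_B} ∪ 𝒱` is `U_J ∪ U_M`. [folklore] -/
theorem biUnion_image_fst_union (S : Finset (Finset (TorusSite d M) × Finset (TorusSite d M)))
    (𝒱 : Finset (Finset (TorusSite d M))) : (S.image Prod.fst ∪ 𝒱).biUnion id = cvSupp (S, 𝒱) := by
  classical
  unfold cvSupp ujOf
  rw [Finset.union_biUnion, Finset.image_biUnion]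
  rfl

/-- **Re-indexing the expansion**: the triple sum over gases `𝒢`, sub-families `𝒱 ⊆ 𝒢` and
sections `S` over `𝒢 ∖ 𝒱` equals the sum over admissible indices `(S, 𝒱)` (with `⋃𝒢 = U_J ∪ U_M`).
[cite: BrydgesSlade2015RGV, Appendix §11 ((11.4)–(11.5): "By interchanging the sums over blocks B … and polymers U_B")] -/
theorem sum_gasSet_sum_sectionSet_eq_sum_cvIndex {β : Type*} [AddCommMonoid β]
    (Φ : Finset (Finset (TorusSite d M) × Finset (TorusSite d M)) → Finset (Finset (TorusSite d M)) →
      Finset (TorusSite d M) → β) :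
    ∑ G ∈ gasSet b, ∑ 𝒱 ∈ G.powerset, ∑ S ∈ sectionSet (G \ 𝒱) (dcol b), Φ S 𝒱 (G.biUnion id) =
      ∑ q ∈ cvIndex b, Φ q.1 q.2 (cvSupp q) := by
  classical
  rw [Finset.sum_sigma', Finset.sum_sigma']
  refine Finset.sum_nbij' (fun y => (y.2, y.1.2)) (fun q => ⟨⟨q.1.image Prod.fst ∪ q.2, q.2⟩, q.1⟩) ?_ ?_ ?_ ?_ ?_
  · rintro ⟨⟨G, 𝒱⟩, S⟩ hy
    simp only [mem_sigma, mem_gasSet, mem_powerset, mem_sectionSet] at hy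
    exact mem_cvIndex.2 (cvAdm_of_isSection hy.1.1 hy.1.2 hy.2)
  · rintro ⟨S, 𝒱⟩ hq
    rw [mem_cvIndex] at hq
    simp only [mem_sigma, mem_gasSet, mem_powerset, mem_sectionSet]
    refine ⟨⟨hq.isGas, subset_union_right⟩, ?_⟩
    rw [union_sdiff_right, sdiff_eq_self_of_disjoint hq.disjoint_image_fst]
    exact hq.isSection
  · rintro ⟨⟨G, 𝒱⟩, S⟩ hy
    simp only [mem_sigma, mem_gasSet, mem_powerset, mem_sectionSet] at hy
    simp only [Sigma.mk.injEq, heq_eq_eq, and_true]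
    rw [hy.2.image_fst, sdiff_union_of_subset hy.1.2]
  · rintro ⟨S, 𝒱⟩ _
    rfl
  · rintro ⟨⟨G, 𝒱⟩, S⟩ hy
    simp only [mem_sigma, mem_gasSet, mem_powerset, mem_sectionSet] at hy
    simp only
    rw [← biUnion_image_fst_union, hy.2.image_fst, sdiff_union_of_subset hy.1.2]

variable (b)

/-- The circle product with the background `I^X` at `Λ`, written as a sum over the polymer
argument of the second factor: `(I ∘ K)(Λ) = Σ_{U ∈ 𝒫} K(U) I^{Λ ∖ U}`. [cite: BrydgesSlade2015RGV, Appendix §11 (first line of (11.3))] -/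
theorem circ_blockProd_univ_eq (F : Finset (TorusSite d M) → R) :
    circ b (blockProd b I) F univ = ∑ U ∈ subpolymers b univ, F U * blockProd b I (univ \ U) := by
  rw [circ_comm _ _ (isPolymer_univ b)]
  rfl

/-- **`(I ∘ K_in)(Λ)` expanded over admissible indices**:
`(I ∘ K_in)(Λ) = Σ_{(S,𝒱)} (∏_{(U,B)∈S} J̄(U,B)) (∏_{V∈𝒱} M(V)) I^{Λ ∖ (U_J ∪ U_M)}`.
[cite: BrydgesSlade2015RGV, Appendix §11, (11.5)] -/
theorem circ_blockProd_univ_eq_sum_cvIndex (hK : ∀ X, IsPolymer b X → K X = ∏ Y ∈ components X, K Y)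
    (hJ : ∀ U B, J U B ≠ 0 → IsSmall b U ∧ B ∈ blocksOf b U) :
    circ b (blockProd b I) K univ = ∑ q ∈ cvIndex b, cvTerm b I K J q * blockProd b I (univ \ cvSupp q) := by
  classical
  rw [circ_blockProd_univ_eq]
  have e1 : ∑ U ∈ subpolymers b univ, K U * blockProd b I (univ \ U) =
      ∑ U ∈ subpolymers b univ, (∏ Y ∈ components U, K Y) * blockProd b I (univ \ U) :=
    Finset.sum_congr rfl fun U hU => by rw [← hK U (mem_subpolymers.1 hU).2]
  rw [e1, sum_subpolymers_univ_eq_sum_gasSet b (fun U G => (∏ Y ∈ G, K Y) * blockProd b I (univ \ U))]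
  simp only [prod_eq_sum_cvTerm b I K J hJ, Finset.sum_mul]
  exact sum_gasSet_sum_sectionSet_eq_sum_cvIndex (fun S 𝒱 U => cvTerm b I K J (S, 𝒱) * blockProd b I (univ \ U))

/-- **Brydges' change of variables ([BS-rg-step] Proposition 4.1.1, (e:Kout-IK))**:
`(I ∘ K_out)(Λ) = (I ∘ K_in)(Λ)` for every block activity `I`, every component-factorising `K_in`
and every `J` supported on `𝒟(J) = {(U,B) : U small, B ∈ ℬ(U)}`, with `K_out` given by
(e:Kdef-new). (The cancellation condition `Σ_U J(U,B) = 0` of (4.2) is not needed for the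
identity; it enters only the estimate (e:Koutbd-KM).) [cite: BrydgesSlade2015RGV, Proposition 4.1.1 (e:Kout-IK) and Appendix §11 (proof)] -/
theorem circ_blockProd_kout_univ (hK : ∀ X, IsPolymer b X → K X = ∏ Y ∈ components X, K Y)
    (hJ : ∀ U B, J U B ≠ 0 → IsSmall b U ∧ B ∈ blocksOf b U) :
    circ b (blockProd b I) (kout b I K J) univ = circ b (blockProd b I) K univ := by
  classical
  rw [circ_blockProd_univ_eq_sum_cvIndex b I K J hK hJ, circ_blockProd_univ_eq]
  symm
  rw [← Finset.sum_fiberwise_of_maps_to (s := cvIndex b) (t := subpolymers b univ) (g := cvW b)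
    (fun q hq => mem_subpolymers.2 ⟨subset_univ _, (mem_cvIndex.1 hq).isPolymer_cvW⟩)]
  refine Finset.sum_congr rfl fun W _ => ?_
  unfold kout
  rw [Finset.sum_mul]
  have hset : (cvIndex b).filter (fun q => cvW b q = W) = cvFiber b W := by
    ext q
    simp only [Finset.mem_filter, mem_cvIndex, mem_cvFiber]
  rw [hset]
  refine Finset.sum_congr rfl fun q hq => ?_
  obtain ⟨hadm, hW⟩ := mem_cvFiber.1 hq
  rcases q with ⟨S, 𝒱⟩
  rw [hadm.blockProd_univ_sdiff_cvSupp I, ← hW]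
  ring

/-! ### Special values of `K_out` -/

omit [NeZero M] in
/-- `X(∅) = ∅`. [folklore] -/
@[simp] theorem xOf_empty : xOf (∅ : Finset (Finset (TorusSite d M) × Finset (TorusSite d M))) = ∅ := by
  simp [xOf]

omit [NeZero M] in
/-- `U_J(∅) = ∅`. [folklore] -/
@[simp] theorem ujOf_empty : ujOf (∅ : Finset (Finset (TorusSite d M) × Finset (TorusSite d M))) = ∅ := by
  simp [ujOf]

/-- `∅^□ = ∅`. [folklore] -/
@[simp] theorem sclosure_empty : sclosure b (∅ : Finset (TorusSite d M)) = ∅ := by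
  ext y
  simp [mem_sclosure]

variable {b}

/-- `X(S)` is nonempty as soon as `S ⊆ 𝒟(J)` is. [folklore] -/
theorem xOf_nonempty {S : Finset (Finset (TorusSite d M) × Finset (TorusSite d M))} (hS : S ⊆ djSet b)
    (hne : S.Nonempty) : (xOf S).Nonempty := by
  classical
  obtain ⟨p, hp⟩ := hne
  obtain ⟨x, hx⟩ := nonempty_of_mem_blocksOf (mem_djSet.1 (hS hp)).2
  exact ⟨x, mem_biUnion.2 ⟨p, hp, hx⟩⟩

/-- An admissible index with `W(S, 𝒱) = ∅` is `(∅, ∅)`. [folklore] -/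
theorem CvAdm.eq_empty_of_cvW_eq_empty {S : Finset (Finset (TorusSite d M) × Finset (TorusSite d M))}
    {𝒱 : Finset (Finset (TorusSite d M))} (h : CvAdm b S 𝒱) (hW : cvW b (S, 𝒱) = ∅) : S = ∅ ∧ 𝒱 = ∅ := by
  classical
  unfold cvW at hW
  rw [union_eq_empty] at hW
  constructor
  · by_contra hS
    obtain ⟨x, hx⟩ := xOf_nonempty h.1 (nonempty_iff_ne_empty.2 hS)
    have := subset_sclosure b (xOf S) hx
    rw [hW.1] at this
    simp at this
  · by_contra h𝒱
    obtain ⟨V, hV⟩ := nonempty_iff_ne_empty.2 h𝒱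
    obtain ⟨x, hx⟩ := (mem_connSet.1 (h.2.1 hV)).2.1
    have : x ∈ 𝒱.biUnion id := mem_biUnion.2 ⟨V, hV, hx⟩
    rw [hW.2] at this
    simp at this

/-- `(∅, ∅)` is admissible. [folklore] -/
theorem cvAdm_empty : CvAdm b (∅ : Finset (Finset (TorusSite d M) × Finset (TorusSite d M))) ∅ := by
  refine ⟨empty_subset _, empty_subset _, ?_, ?_, ?_⟩ <;> simp

variable (b)

/-- `𝒴(∅) = {(∅, ∅)}`. [folklore] -/
theorem cvFiber_empty : cvFiber b (∅ : Finset (TorusSite d M)) = {(∅, ∅)} := by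
  ext q
  rw [mem_cvFiber, mem_singleton]
  constructor
  · rintro ⟨hadm, hW⟩
    rcases q with ⟨S, 𝒱⟩
    obtain ⟨rfl, rfl⟩ := hadm.eq_empty_of_cvW_eq_empty hW
    rfl
  · rintro rfl
    refine ⟨cvAdm_empty, ?_⟩
    simp [cvW]

/-- **`K_out(∅) = 1`** (the normalisation `F(∅) = 1` of polymer activities is preserved).
[cite: BrydgesSlade2015RGV, §1.4 ("All functions F : 𝒫_j → 𝒩 that we consider are required to obey F(∅) = 1")] -/
theorem kout_empty : kout b I K J ∅ = 1 := by
  unfold kout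
  rw [cvFiber_empty, Finset.sum_singleton]
  simp [cvTerm, cvSupp]

/-- The `M`-term of `K_out(W)`: the index `(∅, Comp(W))` is in `𝒴(W)` for a polymer `W`.
[cite: BrydgesSlade2015RGV, Appendix §11 ("the terms with X = ∅, U_M = W")] -/
theorem mem_cvFiber_components {W : Finset (TorusSite d M)} (hW : IsPolymer b W) : (∅, components W) ∈ cvFiber b W := by
  classical
  have hG := isGas_components hW
  refine mem_cvFiber.2 ⟨⟨empty_subset _, fun Y hY => mem_connSet.2 (hG.1 Y hY), by simp, hG.2, by simp⟩, ?_⟩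
  simp [cvW, biUnion_components_id]

variable {b} in
/-- An admissible index `(∅, 𝒱)` in `𝒴(W)` has `𝒱 = Comp(W)`. [folklore] -/
theorem CvAdm.eq_components_of_cvW_eq {𝒱 : Finset (Finset (TorusSite d M))} {W : Finset (TorusSite d M)}
    (h : CvAdm b ∅ 𝒱) (hW : cvW b (∅, 𝒱) = W) : 𝒱 = components W := by
  classical
  have hG : IsGas b 𝒱 := ⟨fun V hV => mem_connSet.1 (h.2.1 hV), h.2.2.2.1⟩
  have : 𝒱.biUnion id = W := by simpa [cvW] using hW
  rw [← this, hG.components_biUnion]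

/-- **`K_out = K_in` when `J = 0`** ("the above formula implies that if `J = 0` then
`K_out = K_in`"). [cite: BrydgesSlade2015RGV, Appendix §11 (after (e:Kdef-new))] -/
theorem kout_eq_of_forall_eq_zero (hK : ∀ X, IsPolymer b X → K X = ∏ Y ∈ components X, K Y)
    (hJ : ∀ U B, J U B = 0) {W : Finset (TorusSite d M)} (hW : IsPolymer b W) : kout b I K J W = K W := by
  classical
  unfold kout
  rw [Finset.sum_eq_single (∅, components W)]
  · have hsupp : cvSupp ((∅ : Finset (Finset (TorusSite d M) × Finset (TorusSite d M))), components W) = W := by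
      simp [cvSupp, biUnion_components_id]
    rw [hsupp, sdiff_self, Finset.bot_eq_empty, blockProd_empty, mul_one]
    unfold cvTerm
    simp only [Finset.prod_empty, one_mul]
    rw [hK W hW]
    refine Finset.prod_congr rfl fun Y _ => ?_
    simp [mfun, hJ]
  · intro q hq hne
    rcases q with ⟨S, 𝒱⟩
    obtain ⟨hadm, hWq⟩ := mem_cvFiber.1 hq
    by_cases hS : S = ∅
    · subst hS
      exact absurd (Prod.ext rfl (hadm.eq_components_of_cvW_eq hWq) :
        ((∅ : Finset (Finset (TorusSite d M) × Finset (TorusSite d M))), 𝒱) = (∅, components W)) hne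
    · obtain ⟨p, hp⟩ := nonempty_iff_ne_empty.2 hS
      have : cvTerm b I K J (S, 𝒱) = 0 := by
        unfold cvTerm
        rw [Finset.prod_eq_zero hp (by simp [jbar, hJ]), zero_mul]
      rw [this, zero_mul]
  · intro h
    exact absurd (mem_cvFiber_components b hW) h

/-! ### The cancellation `Σ_{U} J(U,B) = 0` kills the single-pair terms ([BS-rg-step] (e:Jcancel)) -/

open Classical in
/-- The small sets through a block `B`: `{U : (U, B) ∈ 𝒟(J)}`. [cite: BrydgesSlade2015RGV, (4.2)] -/
def djFiber (b : ℕ) (B : Finset (TorusSite d M)) : Finset (Finset (TorusSite d M)) :=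
  univ.filter fun U => IsSmall b U ∧ B ∈ blocksOf b U

variable {b} in
/-- Membership in `djFiber`. [folklore] -/
@[simp] theorem mem_djFiber {B U : Finset (TorusSite d M)} : U ∈ djFiber b B ↔ IsSmall b U ∧ B ∈ blocksOf b U := by
  classical
  simp [djFiber]

/-- The single-pair indices `({(U,B)}, ∅)`: `|X| = 1` and `U_M = ∅`. [cite: BrydgesSlade2015RGV, Appendix §11 ("triples with |X| = 1 and U_M = ∅")] -/
def IsSinglePair (q : Finset (Finset (TorusSite d M) × Finset (TorusSite d M)) × Finset (Finset (TorusSite d M))) : Prop :=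
  q.1.card = 1 ∧ q.2 = ∅

open Classical in
/-- The single-pair part of `𝒴(W)`. [cite: BrydgesSlade2015RGV, Appendix §11] -/
def cvFiberSingle (b : ℕ) (W : Finset (TorusSite d M)) :
    Finset (Finset (Finset (TorusSite d M) × Finset (TorusSite d M)) × Finset (Finset (TorusSite d M))) :=
  (cvFiber b W).filter IsSinglePair

open Classical in
/-- `𝒴₀(W)`: `𝒴(W)` without the `M`-index `(∅, Comp(W))` and without the single-pair indices.
[cite: BrydgesSlade2015RGV, Appendix §11 (definition of 𝒴₀(W))] -/
def cvFiber₀ (b : ℕ) (W : Finset (TorusSite d M)) :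
    Finset (Finset (Finset (TorusSite d M) × Finset (TorusSite d M)) × Finset (Finset (TorusSite d M))) :=
  (cvFiber b W).filter fun q => q ≠ (∅, components W) ∧ ¬ IsSinglePair q

/-- `({p}, ∅)` is admissible for `p ∈ 𝒟(J)`. [folklore] -/
theorem cvAdm_singleton {p : Finset (TorusSite d M) × Finset (TorusSite d M)} (hp : p ∈ djSet b) :
    CvAdm b {p} ∅ := by
  refine ⟨by simpa using hp, empty_subset _, ?_, by simp, by simp⟩
  intro p' hp' q' hq' hne
  rw [mem_singleton] at hp' hq'
  exact absurd (hp'.trans hq'.symm) hne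

omit [NeZero M] in
/-- `X({p}) = B`. [folklore] -/
@[simp] theorem xOf_singleton (p : Finset (TorusSite d M) × Finset (TorusSite d M)) : xOf {p} = p.2 := by
  simp [xOf]

omit [NeZero M] in
/-- `U_J({p}) = U`. [folklore] -/
@[simp] theorem ujOf_singleton (p : Finset (TorusSite d M) × Finset (TorusSite d M)) : ujOf {p} = p.1 := by
  simp [ujOf]

/-- The value of a single-pair term: `J̄(U,B) I^{W ∖ U} = J(U,B) I^{W}` for `W = B^□ ⊇ U`.
[cite: BrydgesSlade2015RGV, Appendix §11, (e:Jcancel)] -/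
theorem cvTerm_singleton_mul {p : Finset (TorusSite d M) × Finset (TorusSite d M)} (hp : p ∈ djSet b)
    {W : Finset (TorusSite d M)} (hW : cvW b ({p}, ∅) = W) :
    cvTerm b I K J ({p}, ∅) * blockProd b I (W \ cvSupp ({p}, ∅)) = blockProd b I W * J p.1 p.2 := by
  classical
  have hWeq : W = sclosure b p.2 := by rw [← hW]; simp [cvW]
  have hU : p.1 ⊆ W := hWeq ▸ fst_subset_sclosure_of_mem_djSet hp (subset_refl _)
  have hsupp : cvSupp ({p}, (∅ : Finset (Finset (TorusSite d M)))) = p.1 := by simp [cvSupp]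
  rw [hsupp]
  unfold cvTerm jbar
  simp only [Finset.prod_singleton, Finset.prod_empty, mul_one]
  rw [blockProd_eq_mul_sdiff I (isPolymer_isConn_of_mem_djSet hp).1 (hWeq ▸ isPolymer_sclosure b p.2) hU]
  ring

/-- **The cancellation (e:Jcancel)**: if `Σ_{U : (U,B) ∈ 𝒟(J)} J(U,B) = 0` for every block `B`, the
single-pair terms (`|X| = 1`, `U_M = ∅`) of `K_out(W)` sum to zero ("This feature is a crucial
ingredient"). [cite: BrydgesSlade2015RGV, (4.2) and Appendix §11, (e:Jcancel)] -/
theorem sum_cvFiberSingle_eq_zero (hcancel : ∀ B : Finset (TorusSite d M), ∑ U ∈ djFiber b B, J U B = 0)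
    (W : Finset (TorusSite d M)) :
    ∑ q ∈ cvFiberSingle b W, cvTerm b I K J q * blockProd b I (W \ cvSupp q) = 0 := by
  classical
  -- reindex by the pair `p = (U, B)`
  have e : ∑ q ∈ cvFiberSingle b W, cvTerm b I K J q * blockProd b I (W \ cvSupp q) =
      ∑ p ∈ (djSet b).filter (fun p => cvW b ({p}, ∅) = W), blockProd b I W * J p.1 p.2 := by
    symm
    refine Finset.sum_bij (fun p _ => (({p} : Finset _), (∅ : Finset (Finset (TorusSite d M))))) ?_ ?_ ?_ ?_
    · intro p hp
      obtain ⟨hp, hW⟩ := Finset.mem_filter.1 hp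
      exact Finset.mem_filter.2 ⟨mem_cvFiber.2 ⟨cvAdm_singleton b hp, hW⟩, by simp, rfl⟩
    · intro p _ p' _ h
      simpa using h
    · rintro ⟨S, 𝒱⟩ hq
      obtain ⟨hq, hcard, h𝒱⟩ := Finset.mem_filter.1 hq
      obtain ⟨p, rfl⟩ := Finset.card_eq_one.1 hcard
      simp only at h𝒱
      subst h𝒱
      obtain ⟨hadm, hW⟩ := mem_cvFiber.1 hq
      exact ⟨p, Finset.mem_filter.2 ⟨hadm.1 (mem_singleton_self p), hW⟩, rfl⟩
    · intro p hp
      obtain ⟨hp, hW⟩ := Finset.mem_filter.1 hp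
      rw [cvTerm_singleton_mul b I K J hp hW]
  rw [e, ← Finset.mul_sum]
  -- group by the block `B = p.2`
  rw [← Finset.sum_fiberwise_of_maps_to (g := Prod.snd)
    (t := ((djSet b).filter (fun p => cvW b ({p}, ∅) = W)).image Prod.snd) fun p hp => mem_image_of_mem _ hp]
  rw [Finset.sum_eq_zero, mul_zero]
  intro B hB
  have hWB : sclosure b B = W := by
    obtain ⟨p, hp, rfl⟩ := mem_image.1 hB
    obtain ⟨-, hW⟩ := Finset.mem_filter.1 hp
    rw [← hW]
    simp [cvW]
  rw [← hcancel B]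
  refine Finset.sum_nbij' Prod.fst (fun U => (U, B)) ?_ ?_ ?_ ?_ ?_
  · intro p hp
    simp only [Finset.mem_filter, mem_djSet] at hp
    obtain ⟨⟨⟨hsmall, hBU⟩, -⟩, rfl⟩ := hp
    exact mem_djFiber.2 ⟨hsmall, hBU⟩
  · intro U hU
    obtain ⟨hsmall, hBU⟩ := mem_djFiber.1 hU
    refine Finset.mem_filter.2 ⟨Finset.mem_filter.2 ⟨mem_djSet.2 ⟨hsmall, hBU⟩, ?_⟩, rfl⟩
    rw [← hWB]
    simp [cvW]
  · intro p hp
    simp only [Finset.mem_filter] at hp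
    obtain ⟨-, rfl⟩ := hp
    rfl
  · intro U _
    rfl
  · intro p hp
    simp only [Finset.mem_filter] at hp
    obtain ⟨-, rfl⟩ := hp
    rfl

/-- **(e:K-M-new)**: for a polymer `W`, `K_out(W) - M(W) = Σ_{𝒴₀(W)} (⋯)`, where
`M(W) = ∏_{Y ∈ Comp(W)} M(Y)` and `𝒴₀(W)` omits the index `(∅, Comp(W))` (whose term is `M(W)`)
and the single-pair indices (which cancel). [cite: BrydgesSlade2015RGV, Appendix §11, (e:K-M-new) and the definition of 𝒴₀(W)] -/
theorem kout_sub_prod_mfun_eq (hcancel : ∀ B : Finset (TorusSite d M), ∑ U ∈ djFiber b B, J U B = 0)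
    {W : Finset (TorusSite d M)} (hW : IsPolymer b W) :
    kout b I K J W - ∏ Y ∈ components W, mfun b I K J Y =
      ∑ q ∈ cvFiber₀ b W, cvTerm b I K J q * blockProd b I (W \ cvSupp q) := by
  classical
  have hM : ∏ Y ∈ components W, mfun b I K J Y =
      cvTerm b I K J (∅, components W) * blockProd b I (W \ cvSupp ((∅ : Finset (Finset (TorusSite d M) × Finset (TorusSite d M))), components W)) := by
    have hsupp : cvSupp ((∅ : Finset (Finset (TorusSite d M) × Finset (TorusSite d M))), components W) = W := by
      simp [cvSupp, biUnion_components_id]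
    rw [hsupp, sdiff_self, Finset.bot_eq_empty, blockProd_empty, mul_one]
    simp [cvTerm]
  unfold kout
  rw [hM, ← Finset.sum_erase_eq_sub (mem_cvFiber_components b hW)]
  have hsplit := Finset.sum_filter_add_sum_filter_not ((cvFiber b W).erase (∅, components W)) IsSinglePair
    (fun q => cvTerm b I K J q * blockProd b I (W \ cvSupp q))
  rw [← hsplit]
  have h1 : ((cvFiber b W).erase (∅, components W)).filter IsSinglePair = cvFiberSingle b W := by
    ext q
    simp only [cvFiberSingle, Finset.mem_filter, Finset.mem_erase, and_congr_left_iff, and_iff_right_iff_imp]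
    rintro ⟨hcard, -⟩ - rfl
    simp at hcard
  have h2 : ((cvFiber b W).erase (∅, components W)).filter (fun q => ¬ IsSinglePair q) = cvFiber₀ b W := by
    ext q
    simp only [cvFiber₀, Finset.mem_filter, Finset.mem_erase, ne_eq]
    tauto
  rw [h1, sum_cvFiberSingle_eq_zero b I K J hcancel W, zero_add, h2]

end ChangeOfVariables

end Polymer

end LongRangePhi4

end Literature.Barriers.CriticalPhenomena
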